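import Mathlib
import HarnessLib
import HarnessLib.Audit
import Summits.Langlands.Statement
import HarnessLib.Audit.Status.Attr

/-!
Route: ExteriorSquareAscent

# Route ExteriorSquareAscent — GL(4) avatars over CM fields are irreducible — the exterior square
ascends from the quadratic field, so no Galois representation over it is needed

X = IrreducibleGL4 ("it suffices to show", a slice of clause (A) of the summit, which asks for
IRREDUCIBLE avatars): for EVERY number field K,
every cuspidal C-algebraic π on GL_4(𝔸_K) with a Hecke field (Clozel) that is NOT essentially
self-dual at Satake level (no GL(1) datum η with
t_(π,v)⁻¹ = η_v t_(π,v) a.e.), every ℓ, ι and every SEMISIMPLE ρ : Gal(K̄/K) → GL_4(ℚ̄_ℓ) that is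
Satake–Frobenius compatible with (π, ι) at
almost all places (C-normalisation `arithFrobPolyOfSatake ι q_v 4`, the convention of lang.S27 =
HLTT/Scholze/Varma) is irreducible. The
statement has teeth exactly where ρ exists — π regular algebraic over totally real or CM K — and its
CM case (non-polarizable π allowed)
is open in print: arXiv:2603.19768 Thm A (March 2026) is stated for totally real K only. No idea
card is realised (operator
open-question harvest); the route sits on the off-sector node of route IrreducibilityBySelfDuality
(its NOT-DECOMPOSED-YET names "the n = 4
part" as a follow-up route). The route decides the summit through the declared open component
RestOfReciprocity (X → Langlands).
Lean: `∀ (K : Type) [Field K] [NumberField K] (h1 :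
Literature.NumberTheory.Automorphic.isCompact_glFiniteIntegralLevel 1 K) (hcpt :
Literature.NumberTheory.Automorphic.isCompact_glFiniteIntegralLevel 4 K) (π :
Literature.NumberTheory.Automorphic.CuspidalAutomorphicRepData 4 K hcpt), π.1.IsCAlgebraic → (∃ E :
Subfield ℂ, FiniteDimensional ℚ E ∧ ∀ᶠ v in cofinite, ∀ α : Multiset ℂ, π.1.HasSatakeParamAt v α → ∀
i ≤ 4, ((((Real.sqrt (v.residueCard : ℝ)) : ℝ) : ℂ) ^ (i * (4 - i))) * α.esymm i ∈ E) → ¬ (∃ η :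
Literature.NumberTheory.Automorphic.CuspidalAutomorphicRepData 1 K h1, ∀ᶠ v in cofinite, ∀ α :
Multiset ℂ, π.1.HasSatakeParamAt v α → ∃ e : ℂ, η.1.HasSatakeParamAt v {e} ∧ α.map (fun a => a⁻¹) =
α.map (fun a => e * a)) → ∀ (ℓ : ℕ) [Fact ℓ.Prime] (ι : PadicAlgCl ℓ ≃+* ℂ) (ρ :
Literature.NumberTheory.GaloisRepresentations.FramedGaloisRep K (PadicAlgCl ℓ) 4),
ρ.toGaloisRep.IsSemisimple → (∀ᶠ v : IsDedekindDomain.HeightOneSpectrum (NumberField.RingOfIntegers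
K) in cofinite, ∃ α : Multiset ℂ, π.1.HasSatakeParamAt v α ∧ ρ.IsUnramifiedAt v ∧
ρ.HasFrobCharpolyAt v (Literature.NumberTheory.Automorphic.arithFrobPolyOfSatake ι v.residueCard 4
α)) → ρ.toGaloisRep.IsIrreducible`

## Assembly
Propositional logic, CHECKED (Sketch.lean rc 0 with this exact `closes`, 2026-08-16): fix K, π, ρ as
in X and suppose ρ reducible;
if π is quadratically self-twisted, SelfTwistedIrreducible gives irreducibility outright; otherwise
ReducibleInducesSquare produces (L, P)
with ∧²-Satake = AI-Satake, and InducedSquareAscent returns 'essentially self-dual' (excluded by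
hypothesis) or 'self-twisted' (excluded
by the case) — contradiction; RestOfReciprocity carries X to `Langlands`:
`theorem closes (h2 : InducedSquareAscent) (h3 : ReducibleInducesSquare) (h4 :
SelfTwistedIrreducible) (h5 : RestOfReciprocity) : _root_.Langlands`.

Rationale: WHY THIS LINE. Shavali's proof (Shavali2026 §4) splits a reducible semisimple avatar as 3+1 — killed
over ANY K by Böckle–Hui local algebraicity of weak
abelian summands (BockleHui2025 Thm 1.1, PROVED IN TREE:
`Literature.NumberTheory.GaloisRepresentations.exists_heckeCharacter_of_weaklyDivides_holds`) plus
Kim's ∧² and Jacquet–Shalika/Shahidi pole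
calculus — or 2+2, where the exterior-cube pole criterion (GinzburgRallis2000, Yamana2014) makes ∧²π
= AI_(L/K)(π') for the quadratic field
L = K(√θ³); he then needs the Galois representation of π' over L, which exists only when L is
totally real or CM — automatic for totally real
K, FALSE for CM K (L = K(√a), a ∈ K⁺ of mixed sign, is not CM). THE LEVER: do not touch π';
base-change π to L instead. ∧²(BC_L π) = π' ⊞ π'^γ
is NOT cuspidal while BC_L π is, so the Asgari–Raghuram criterion in its unconditional direction
(AsgariRaghuram2007 Thm 1 (i)⇒(iii), §4
Props 11–12: Langlands–Shahidi on GSpin(2m+6) + Kim, no descent) makes BC_L π essentially self-dual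
or self-twisted, and a QUADRATIC ASCENT
lemma (H¹(Gal(L/K), C_L) = 0 ⇒ a Gal(L/K)-invariant Hecke character of L is λ₀∘N; Arthur–Clozel: the
cuspidal fibre of quadratic base change
is {π, π ⊗ ε_(L/K)}) carries either property down to π — contradiction. Imported: analytic theory of
automorphic L-functions (exterior
square/cube poles, RS non-vanishing), class field theory (idele-class cohomology), quadratic base
change/automorphic induction formalism
(ArthurClozelAMS120), transcendence of locally algebraic characters (BH); NO Shimura variety, NO
p-adic Hodge theory, NO lifting — which is
why non-polarizable π over CM fields and a non-CM auxiliary field are in scope. The induced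
(self-twisted) case, where Shavali's Cor. 4.6
also invokes Galois representations over the quadratic field, is closed Galois-free by
Brauer–Nesbitt shapes, exact GL(1) Euler products and
Ramakrishnan's refined strong multiplicity one (Ramakrishnan1994, density 1/8) fed by a
Rankin–Selberg 1/9 bound.

RANKED CRUXES. #0 IrreducibleGL4 (target) — X as in § Thesis — any number field K; π cuspidal on
GL_4(𝔸_K), C-algebraic, with a Hecke field, not essentially self-dual at Satake level; then every
semisimple ρ : Gal_K → GL_4(ℚ̄_ℓ) C-compatible with (π, ι) a.e. is irreducible. Derived inside
`closes` from cruxes 2–4 by propositional logic (case split on 'π quadratically self-twisted'). (why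
it might fail: Only through its inputs: a cuspidal GL(4) form over a CM field with a reducible
ℓ-adic avatar at some ι would refute Ramakrishnan's cuspidal⇒irreducible expectation and clause (A)
of the summit itself.) [Shavali2026, BockleHui2025, Dai2025, arXiv:math/0609460]
#2 InducedSquareAscent (crux) — THE LEVER (purely automorphic, any number field K, no Galois
representation anywhere). Let π be cuspidal on GL_4(𝔸_K), L/K quadratic, P cuspidal on GL_3(𝔸_L),
and suppose that at almost every finite v the exterior-square Satake multiset {t_i t_j}_(i<j) of π_v
equals the automorphic-induction multiset of P at v (split v: t_(P,w₁) ⊔ t_(P,w₂); inert v: the six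
square roots ±√b of t_(P,w)). Then π is essentially self-dual at Satake level (∃ GL(1) datum η,
t_(π,v)⁻¹ = η_v·t_(π,v) a.e.) OR π is self-twisted by the quadratic sign of some quadratic L'/K a.e.
Proof line: Kim's ∧²π and AI_(L/K)(P) are isobaric with equal Satake a.e. ⇒ equal (JS); if BC_L π is
not cuspidal, π ≅ π⊗ε_(L/K) (AC) ⇒ self-twisted; else ∧²(BC_L π) = BC_L(∧²π) = P ⊞ P^γ is not
cuspidal ⇒ AR Thm 1 (i)⇒(iii) over L: BC_L π ≅ (BC_L π)^∨ ⊗ λ' or BC_L π ≅ BC_L π ⊗ ξ (ξ ≠ 1, ξ⁴ =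
1); γ-conjugating, BC_L π ≅ BC_L π ⊗ (λ'/λ'^γ), so either λ' is γ-invariant ⇒ λ' = λ₀∘N
(H¹(Gal(L/K), C_L) = 0 + extension from N(C_L)) ⇒ π^∨ ≅ π ⊗ λ₀ ε^j (AC fibre), or BC_L π has a
self-twist whose square (resp. itself) is γ-invariant of order 2 ⇒ = ξ₀∘N ⇒ π ≅ π ⊗ ξ₀ε^j with
(ξ₀ε^j)² = 1 (order 4 would make BC_L π non-cuspidal). [difficulty: L] (why it might fail: AR
(i)⇒(iii) rests on Langlands–Shahidi normalisation for GSpin(2m+6) (AR Prop. 'LSfact',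
Kim–Shahidi/Asgari inputs) — a gap there, or an overlooked exceptional fibre of quadratic base
change / a non-γ-invariant similitude character escaping both branches, breaks the ascent.)
[AsgariRaghuram2007, arXiv:0712.4315, Kim2003, ArthurClozelAMS120, JacquetShalikaAJM1981II,
LabesseLanglands1979]
#3 ReducibleInducesSquare (crux) — Shavali2026 Props 4.1 + 4.2 over ANY number field K (the printed
question: Thm A is stated for totally real K; p. 10 'Throughout this section K is totally real';
Lemma 4.3–Prop. 4.5 need ρ_(π') over the quadratic field). Let π be cuspidal on GL_4(𝔸_K) with a
Hecke field, not essentially self-dual and not quadratically self-twisted at Satake level; let ρ :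
Gal_K → GL_4(ℚ̄_ℓ) be semisimple, C-compatible with (π, ι) a.e., and REDUCIBLE. Then there are a
quadratic L/K and a cuspidal P on GL_3(𝔸_L) whose automorphic-induction Satake data match the
exterior-square Satake data of π a.e. (the hypothesis of crux 2). Proof line: a stable line τ is
impossible (BH Thm 1.1 makes τ and det of the 3-dimensional complement algebraic Hecke characters;
the exact eight-term Frobenius-multiset identity ∧²ρ⊗τ⁻² ⊕ τ⁻³det σ ⊕ 1 = ρ^∨⊗det σ·τ⁻² ⊕ ρ⊗τ⁻¹
gives L^S(s,∧²π⊗η⁻²)L^S(s,η⁻³χ)ζ^S_K(s) = L^S(s,π^∨⊗χη⁻²)L^S(s,π⊗η⁻¹): RHS entire, LHS has a pole —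
Shahidi1997 non-vanishing); so ρ = σ ⊕ τ with 2-dimensional summands, det σ, det τ algebraic (BH on
∧²ρ), ∧²π cuspidal (AR, since π is neither ess. self-dual nor self-twisted), and Shavali's ∧³∘∧²
virtual identity forces a pole of L^S(s, ∧²π, ∧³⊗χ⁻³) at s = 1, whence (GinzburgRallis2000 +
Yamana2014) ∧²π = AI_(L/K)(P), L = K(√(χ³η⁻³)), P cuspidal on GL_3(𝔸_L); read off Satake data a.e.
[difficulty: XL] (why it might fail: Fine print of GinzburgRallis2000/Yamana2014 as used in Shavali
Prop 4.2 (meromorphy of the PARTIAL ∧³ L-function at s = 1, unitarity/twist normalisation ω_Π²χ⁻¹² =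
1, any number field); weights of χ, η must be shown 0 (JS bounds) before non-vanishing at s = 1
applies.) [Shavali2026, arXiv:2603.19768, BockleHui2025, GinzburgRallis2000, Yamana2014,
Shahidi1997, Kim2003, AsgariRaghuram2007, JacquetShalikaAJM1981II]
#4 SelfTwistedIrreducible (crux) — the induced case WITHOUT Galois representations over the
quadratic field (Shavali Cor. 4.6 writes 'L is either totally real or CM', which fails for
mixed-signature quadratic L already over totally real K and for non-CM L over CM K). Let π be
cuspidal C-algebraic on GL_4(𝔸_K) with a Hecke field, self-twisted by the quadratic sign of L/K
a.e.; then every semisimple C-compatible ρ is irreducible. Proof line: π = AI_(L/K)(f), f cuspidal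
on GL_2(𝔸_L), f ≇ f^γ (ArthurClozel / AR Lemma 13); ρ ≅ ρ ⊗ ε_(L/K) (Brauer–Nesbitt), so a reducible
ρ either has four characters in ρ|_L (BH over L ⇒ algebraic Hecke characters ψ_i with t_(f,w) ⊔
t_(f^γ,w) = {ψ_i(w)}: the exact GL(1) product L^T(s,(f ⊞ f^γ)⊗ψ₁⁻¹) = ζ_L^T(s)·∏_(i≥2)
L^T(s,ψ_iψ₁⁻¹) is entire on one side and has a pole on the other) or ρ = V ⊕ V⊗ε with W = V|_L
irreducible, so t_(f,w) ⊔ t_(f^γ,w) is a doubled pair at every unramified w: f_w ≅ f^γ_w off the set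
where t_(f,w) is scalar, which has upper Dirichlet density ≤ 1/9 (|tr Ad f_w|² = 9 there against the
simple pole of L(s, Ad f × Ad f), prime powers controlled by the 7/64 bound) when f is non-dihedral
— below Ramakrishnan's 1/8, so f ≅ f^γ, contradicting cuspidality of π; for dihedral f =
AI_(M/L)(λ), λ is algebraic because π is C-algebraic, ρ ≅ Ind_M^K(λ_ℓ) (Weil avatar +
Brauer–Nesbitt) and Mackey gives irreducibility from cuspidality. [difficulty: L] (why it might
fail: Ramakrishnan1994's 1/8 is a (Dirichlet?) density bound and the RS estimate reaches 1/9 only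
with prime-power control needing θ < 1/8 (7/64, BlomerBrumley2011); a density-notion mismatch, or
dihedral f with λ/λ^c of small order, pushes onto the Weil-avatar branch over a non-TR/CM field.)
[Ramakrishnan1994, BlomerBrumley2011, BockleHui2025, GelbartJacquet1978, ArthurClozelAMS120,
LabesseLanglands1979, Shavali2026, JacquetShalikaAJM1981II]
#5 RestOfReciprocity (crux) — THE REST OF THE MOUNTAIN (declared open component, hub convention for
sector routes on this all-fields/all-ranks summit, cf. PicardMuOrdinary.SectorComplement,
QuadraticWindow.BeyondTheWindow,
IrreducibilityBySelfDuality.IrreducibleOffSector/ReciprocityUpToIrreducibility): IrreducibleGL4 →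
Langlands. It contains everything X does not claim — direction (B), existence of avatars and
local–global compatibility at every finite place, irreducibility for every (n, K, π) outside the
sector (n ≠ 4, or π essentially self-dual, or no Hecke field), the datum Rec — and is trivially
implied by `Langlands`. Not attacked by this route; refuters/judges: grade the route on cruxes 2–4.
[difficulty: open-problem] (why it might fail: It is the summit minus X: open problem (both
directions of reciprocity for GL_n over number fields); fails only if the summit statement itself is
false or mistyped.) [BuzzardGeeLMS2014, FontaineMazurGeometric1995, HarrisLanTaylorThorneRMS2016,
Calegari2023]

TWO-LAYER PLAN. Foreseen glued splits (nothing filed now): ReducibleInducesSquare ⇐ NoStableLine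
(Shavali Prop 4.1 over any K: Hecke field + semisimple
C-compatible ρ ⇒ no ρ-stable line; BH + Kim ∧² + Shahidi1997) → StablePlaneInducesSquare (Prop 4.2:
stable plane, no stable line, ¬ess-self-dual,
¬self-twisted ⇒ ∃ (L, P); BH + GR2000 + Yamana2014) → ReducibleInducesSquare (glue: a reducible
semisimple 4-dimensional representation has a
stable line or a stable plane). InducedSquareAscent ⇐ QuadraticAscent (BC_L π cuspidal and
essentially self-dual or self-twisted ⇒ π essentially
self-dual or quadratically self-twisted: H90 for C_L + AC fibres; Satake-level statement with
L-places) → ARoverL (Kim ∧² = AI(P) a.e. ⇒ BC_L π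
non-cuspidal or exceptional in AR's sense (iii)) → InducedSquareAscent. SelfTwistedIrreducible ⇐
PotentiallyAbelianShapes (four algebraic
characters in ρ|_L are impossible: exact GL(1) Euler products) → DoubledPairRigidity (t_(f,w) ⊔
t_(f^γ,w) doubled a.e. ⇒ f ≅ f^γ or f dihedral-CM:
Ramakrishnan1994 + RS 1/9) → SelfTwistedIrreducible.

KILL CRITERIA. (1) A cuspidal C-algebraic π on GL_4 over a CM (or any) field with a reducible
semisimple avatar at some ι refutes X and clause (A) of the summit
— close `refuted:IrreducibleGL4` (and flag the summit). (2) InducedSquareAscent refuted AS STATED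
(an automorphic π, quadratic L, cuspidal P with
matching ∧²/AI Satake data, π neither ess. self-dual nor quadratically self-twisted): SUBSTANTIVE
for the lever — the only repair is Shavali's
(Galois representations of π' over L), which needs L totally real/CM, so retire
`refuted:InducedSquareAscent` unless the witness has L CM. (3)
ReducibleInducesSquare refuted through the GR/Yamana fine print (e.g. an extra source of poles of
L(s,Π,∧³⊗χ)) ⇒ refuted-misstated: add the
repaired item with the extra disjunct (the other pole source) and extend crux 2 to it; through a
normalisation slip (q_v^(1/2), C- vs L-,
`arithFrobPolyOfSatake ι q 4` vs `… 1`, sign of the inert square roots) ⇒ misstated, restate. (4)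
SelfTwistedIrreducible refuted by a
density subtlety ⇒ repair by the Weil-avatar branch under `IsCAlgebraic` for dihedral f, or concede
the induced case to RestOfReciprocity (X
restated with ¬self-twisted; the lever is unaffected). (5) A paper proving Thm A of arXiv:2603.19768
over CM fields by any method (searched
2026-08-16: `lit citing arxiv:2603.19768` = 0; Dai2025 §1 state of the art lists no CM n = 4
non-polarized result) ⇒ `superseded`/known for
staffing; the glue still decides the summit.

NOT DECOMPOSED YET. The printed inputs are NOT filed as items (each is a Literature-side named fact
the first prover states and `fact claim`s, D-0027 §3.3):
Kim2003 (∧² : GL_4 → GL_6 isobaric with Satake {t_i t_j} a.e., and its compatibility with base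
change), AsgariRaghuram2007 Thm 1 (i)⇒(iii),
ArthurClozelAMS120 quadratic base change / automorphic induction for GL_2, GL_3, GL_4, GL_6
(existence, Satake description, cuspidality of BC,
fibres), JacquetShalikaAJM1981II Thm 4.4 (isobaric SMO) and (2.2) (pair-L boundary, IN TREE as item
PairLBoundaryJS text), Shahidi1997,
GinzburgRallis2000 + Yamana2014 (∧³ pole criterion), Ramakrishnan1994 (1/8), BlomerBrumley2011
(7/64), Gelbart–Jacquet (Ad f cuspidal),
Weil's ℓ-adic avatar of an algebraic Hecke character over an arbitrary number field, H¹(Gal(L/K),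
C_L) = 0 (Mathlib/tree class field theory).
The children of § Two-layer plan; the linear algebra 'reducible semisimple rank 4 ⇒ stable line or
stable plane' (a --supports lemma); the
GL(1) dictionary (IN TREE: GLOneOfHeckeCharacterBJ, AutomorphicRepsGLOneHeckeCharacter). Essentially
self-dual π over CM (polarizable: Hui2023 a.a. λ;
non-polarizable symplectic-type: open) and n = 5, 6 stay in RestOfReciprocity.

CHEAPEST FALSIFIER. LOOKUPS, all run this session: (i) does AR's converse need descent? — READ
arXiv:0712.4315 §1 Thm 1 and §4: '(i)⇒(iii)' is Props 11–12
(Langlands–Shahidi + Kim), descent enters only (iii)⇒(ii) — passes; (ii) is the CM n = 4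
non-polarized case already in print? — `lit citing
arxiv:2603.19768` = 0, Dai2025 §1 (Oct 2025) and Shavali2026 §1 list none — passes; (iii) ONE PAGE
BY HAND (done in NOTES.md): the quadratic ascent
(H¹(Gal(L/K),C_L) = 0 ⇒ γ-invariant characters factor through N; self-twist orders divide 4; order-4
descent contradicts cuspidality of BC_L π) —
passes. The refuter's next cheapest kill: re-derive Shavali Prop 4.2 line by line over an imaginary
quadratic K and check every cited analytic
input is stated over arbitrary number fields (GinzburgRallis2000 §, Yamana2014 Thm, Shahidi1997 Thm
1.1).

NUMBERS. n = 4; [L : K] = 2; densities: scalar-Satake set ≤ 1/9 < 1/8 (Ramakrishnan1994); Ramanujan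
bound needed θ < 1/8, available 7/64 (BlomerBrumley2011);
self-twist orders ∣ 4; items at open: 6 (1 target, 4 cruxes, 1 assembly); `closes` binders: 4, all
load-bearing (Sketch.lean rc 0).
State of the art (Dai2025 §1, Shavali2026 §1): n = 3 CM polarized [BR92]; n = 3 totally real
[BockleHui2025]; n = 3 CM non-polarized = in-tree
IrreducibleGL3CM; n = 4 totally real ess. self-dual a.a. ℓ [Ramakrishnan 2013]; polarized n ≤ 6 a.a.
λ [Hui2023]; n = 4 totally real
non-ess-self-dual all λ [Shavali2026]; n = 4 CM non-ess-self-dual: this route.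

DEFINITION REQUESTS. None blocking: every constant of the six items is in the import closure of
`Summits.Langlands.Statement` or Mathlib (Sketch.lean rc 0):
CuspidalAutomorphicRepData, HasSatakeParamAt, IsCAlgebraic, isCompact_glFiniteIntegralLevel,
arithFrobPolyOfSatake, FramedGaloisRep, IsSemisimple,
IsIrreducible, IsUnramifiedAt, HasFrobCharpolyAt, Multiset.powersetCard/esymm,
Ideal.under/inertiaDeg. Bib keys added this session:
AsgariRaghuram2007, GinzburgRallis2000, Shahidi1997, BlomerBrumley2011 (Shavali2026, Yamana2014
existed).

Novelty: Searches (2026-08-16): `lit frontier Langlands --since 2023` (60 rows; read arXiv:2603.19768,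
2602.16452, 2605.03519, 2603.18961, 2008.09852 at page level);
`lit citing arxiv:2603.19768` (0); `lit search --source arxiv "irreducibility automorphic Galois
representations"` (6: 2603.19768, 2208.04002, 2510.12496,
2207.04925, 2507.22631, 2407.12566 — all totally real / polarized / ℚ); `lit search --source arxiv
"weak abelian direct summands"` (1: 2404.08954);
`lit search --source arxiv "essentially self-dual quadratic base change descent cuspidal GL(4)"`
(0); `lit read arxiv:0712.4315` (AR Thm 1 + §4 read);
`lit read arxiv:2510.12496` p. 3 (state of the art); `ledger negatives --problem Langlands` (1,
unrelated); the 46 open routes' levers (NOTES.md).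
Nearest prior art found: Shavali2026 = arXiv:2603.19768 (Thm A over totally real K; §4.2 closes the
2+2 case with ρ_(π') over the quadratic field,
Lemma 4.3 'K' is totally real' uses complex conjugation in Gal_K); BockleHui2025 (n = 3, the
local-algebraicity engine); AsgariRaghuram2007 (the
criterion, never applied over the auxiliary quadratic field in an irreducibility proof); in-hub
IrreducibilityBySelfDuality (n = 3 over CM by
adjoint descent + half-integral twists — a different rank and lever).
Delta: replaces the Galois representation over the quadratic field by Asgari–Raghuram's
unconditional direction applied to BC_L π plus a class-field-theoretic
ascent of self-duality/self-twist along L/K, making Shavali's argument field-in  [refs: 2603.19768, 0712.4315, 2510.12496, arxiv:2603.19768, arxiv:0712.4315, arxiv:2510.12496, Shavali2026, BockleHui2025, AsgariRaghuram2007]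

Barriers (technique_class: l-function-poles, exterior-square, quadratic-ascent): - technique_class: l-function-poles, exterior-square, quadratic-ascent
- Literature.Barriers.Langlands.ShimuraVarietyRealizationBarrier: evaded by design — the auxiliary
field L = K(√θ³) may be neither totally real nor CM and NOTHING is constructed over it (no ρ_(π'),
no ρ_f); the avatar ρ over K enters only as a universally quantified compatible representation, so
the statement is non-vacuous exactly where lang.S27 supplies ρ (K totally real/CM, π regular) and
costs nothing elsewhere.
- Literature.Barriers.Langlands.NonRegularWeightBarrier: not met — no cohomology, interpolation or
weights are used; X carries `IsCAlgebraic` only (needed for the Weil avatar in the dihedral sub-case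
of crux 4), so the argument is weight-blind and would apply verbatim to irregular π the day their
avatars exist.
- Literature.Barriers.Langlands.TwistedEndoscopySelfDual: used in reverse and only where printed —
reducibility is shown to FORCE π into the θ-stable/self-twisted locus (AR's GSpin/GSp/induced
types), via Kim's ∧² (a theorem for GL_4) and quadratic base change (a theorem); no functoriality
for non-self-dual π is assumed.
- Literature.Barriers.Langlands.SolvableImageBarrier: not met — base change along ONE quadratic
extension is used formally (fibres {π, π⊗ε}, H90 for C_L), never to trivialise an image or to
descend automorphy.
- Negatives index: 1 entry for the summit (K3KugaSatakeDescent Serre-type anchor,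
stmt-Langlands-3797) — unrelated; no refuted statement is restated.

Novelty grade: new-combination — REVIEW (rreview-0816T23-1, refuter, 2026-08-17): KEEP OPEN. 6 decls elaborate (W.lean rc0; closes sorry-free, axioms standard); simp/aesop fail, simp_all times out on r2/r3; no vacuity (ramified v absorbed by cofinite; GL1 cusp data = all Hecke chars; quadratic sign via Mathlib-2026 Ideal.inertiaDeg (refuter refuter-rreview-0816T23-1-0, 2026-08-17T00:27:15Z; prior: arXiv:2603.19768, arXiv:0712.4315, BockleHui2025, doi:10.1007/s00209-014-1366-7)

History (route lifecycle, newest last):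
- 2026-08-25T07:15:23Z · DORMANT — reconciler: no traction for 7.5 d (last activity item-evidence-added at 2026-08-17T19:05:05Z); parked, not closed — `ledger route dormant route-Langlands-Exteri (operator:999:112766)
- 2026-08-29T00:27:43Z · REACTIVATED — reconciler: reactivated — activity statement-checked at 2026-08-28T21:32:13Z after parking at 2026-08-25T07:15:23Z (operator:999:4125328)

sub-problem: Langlands · status: open · opened planner-plan-novel-Langlands-Langlands-e266a39d-a-v2-g11-0 2026-08-16T23:57:24Z · rev 7 · ledger route-Langlands-ExteriorSquareAscent
GENERATED by the gate from the ledger (D-0016/17). Provers cite these decls: `theorem foo : Summit.Langlands.Langlands.Theses.ExteriorSquareAscent.<Decl> := …` in Summits/Langlands/Langlands/Theorems/<Name>.lean.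
-/

namespace Summit.Langlands.Langlands.Theses.ExteriorSquareAscent

open scoped BigOperators Topology Manifold Classical MeasureTheory ProbabilityTheory Matrix InnerProductSpace ComplexConjugate ContinuousMap
open Filter Set Function TopologicalSpace MeasureTheory

attribute [summit_statement] _root_.Langlands

/-- item stmt-Langlands-18052 · target · rank 0 · open · by planner
why it might fail: Only through its inputs: a cuspidal GL(4) form over a CM field with a reducible ℓ-adic avatar at some ι would refute Ramakrishnan's cuspidal⇒irreducible expectation and clause (A) of the summit itself.
sources: Shavali2026, BockleHui2025, Dai2025, arXiv:math/0609460
[target] X as in § Thesis — any number field K; π cuspidal on GL_4(𝔸_K), C-algebraic, with a Hecke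
field, not essentially self-dual at Satake level; then every semisimple ρ : Gal_K → GL_4(ℚ̄_ℓ)
C-compatible with (π, ι) a.e. is irreducible. Derived inside `closes` from cruxes 2–4 by
propositional logic (case split on 'π quadratically self-twisted'). -/
@[route_item "route-Langlands-ExteriorSquareAscent"]
def IrreducibleGL4 : Prop :=
  ∀ (K : Type) [Field K] [NumberField K] (h1 : Literature.NumberTheory.Automorphic.isCompact_glFiniteIntegralLevel 1 K) (hcpt : Literature.NumberTheory.Automorphic.isCompact_glFiniteIntegralLevel 4 K) (π : Literature.NumberTheory.Automorphic.CuspidalAutomorphicRepData 4 K hcpt), π.1.IsCAlgebraic → (∃ E : Subfield ℂ, FiniteDimensional ℚ E ∧ ∀ᶠ v in cofinite, ∀ α : Multiset ℂ, π.1.HasSatakeParamAt v α → ∀ i ≤ 4, ((((Real.sqrt (v.residueCard : ℝ)) : ℝ) : ℂ) ^ (i * (4 - i))) * α.esymm i ∈ E) → ¬ (∃ η : Literature.NumberTheory.Automorphic.CuspidalAutomorphicRepData 1 K h1, ∀ᶠ v in cofinite, ∀ α : Multiset ℂ, π.1.HasSatakeParamAt v α → ∃ e : ℂ, η.1.HasSatakeParamAt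 v {e} ∧ α.map (fun a => a⁻¹) = α.map (fun a => e * a)) → ∀ (ℓ : ℕ) [Fact ℓ.Prime] (ι : PadicAlgCl ℓ ≃+* ℂ) (ρ : Literature.NumberTheory.GaloisRepresentations.FramedGaloisRep K (PadicAlgCl ℓ) 4), ρ.toGaloisRep.IsSemisimple → (∀ᶠ v : IsDedekindDomain.HeightOneSpectrum (NumberField.RingOfIntegers K) in cofinite, ∃ α : Multiset ℂ, π.1.HasSatakeParamAt v α ∧ ρ.IsUnramifiedAt v ∧ ρ.HasFrobCharpolyAt v (Literature.NumberTheory.Automorphic.arithFrobPolyOfSatake ι v.residueCard 4 α)) → ρ.toGaloisRep.IsIrreducible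

/-- item stmt-Langlands-18053 · crux · rank 2 · open · by planner
why it might fail: AR (i)⇒(iii) rests on Langlands–Shahidi normalisation for GSpin(2m+6) (AR Prop. 'LSfact', Kim–Shahidi/Asgari inputs) — a gap there, or an overlooked exceptional fibre of quadratic base change / a non-γ-invariant similitude character escaping both branches, breaks the ascent.
sources: AsgariRaghuram2007, arXiv:0712.4315, Kim2003, ArthurClozelAMS120, JacquetShalikaAJM1981II, LabesseLanglands1979
[crux] THE LEVER (purely automorphic, any number field K, no Galois representation anywhere). Let π
be cuspidal on GL_4(𝔸_K), L/K quadratic, P cuspidal on GL_3(𝔸_L), and suppose that at almost every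
finite v the exterior-square Satake multiset {t_i t_j}_(i<j) of π_v equals the automorphic-induction
multiset of P at v (split v: t_(P,w₁) ⊔ t_(P,w₂); inert v: the six square roots ±√b of t_(P,w)).
Then π is essentially self-dual at Satake level (∃ GL(1) datum η, t_(π,v)⁻¹ = η_v·t_(π,v) a.e.) OR π
is self-twisted by the quadratic sign of some quadratic L'/K a.e. Proof line: Kim's ∧²π and
AI_(L/K)(P) are isobaric with equal Satake a.e. ⇒ equal (JS); if BC_L π is not cuspidal, π ≅
π⊗ε_(L/K) (AC) ⇒ self-twisted; else ∧²(BC_L π) = BC_L(∧²π) = P ⊞ P^γ is not cuspidal ⇒ AR Thm 1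
(i)⇒(iii) over L: BC_L π ≅ (BC_L π)^∨ ⊗ λ' or BC_L π ≅ BC_L π ⊗ ξ (ξ ≠ 1, ξ⁴ = 1); γ-conjugating,
BC_L π ≅ BC_L π ⊗ (λ'/λ'^γ), so either λ' is γ-invariant ⇒ λ' = λ₀∘N (H¹(Gal(L/K), C_L) = 0 +
extension from N(C_L)) ⇒ π^∨ ≅ π ⊗ λ₀ ε^j (AC fibre), or BC_L π has a self-twist whose square (resp.
itself) is γ-invariant of order 2 ⇒ = ξ₀∘N ⇒ π ≅ π ⊗ ξ₀ε^j with (ξ₀ε^j)² = 1 (order 4 would make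
BC_L π non-cuspidal). [difficul -/
@[route_item "route-Langlands-ExteriorSquareAscent", crux]
def InducedSquareAscent : Prop :=
  ∀ (K : Type) [Field K] [NumberField K] (h1 : Literature.NumberTheory.Automorphic.isCompact_glFiniteIntegralLevel 1 K) (hcpt : Literature.NumberTheory.Automorphic.isCompact_glFiniteIntegralLevel 4 K) (π : Literature.NumberTheory.Automorphic.CuspidalAutomorphicRepData 4 K hcpt) (L : Type) [Field L] [NumberField L] [Algebra K L], Module.finrank K L = 2 → ∀ (hL3 : Literature.NumberTheory.Automorphic.isCompact_glFiniteIntegralLevel 3 L) (P : Literature.NumberTheory.Automorphic.CuspidalAutomorphicRepData 3 L hL3), (∀ᶠ v : IsDedekindDomain.HeightOneSpectrum (NumberField.RingOfIntegers K) in cofinite, ∀ α : Multiset ℂ, π.1.HasSatakeParamAt v α → ((∃ w : IsDedekindDomain.HeightOneSpectrum (NumberField.RingOfIntegers L), w.asIdeal.under (NumberField.RingOfIntegers K) = v.asIdeal ∧ w.asIdeal.inertiaDeg (NumberField.RingOfIntegers K) = 1) → ∃ w₁ w₂ : IsDedekindDomain.HeightOneSpectrum (NumberField.RingOfIntegers L),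 w₁ ≠ w₂ ∧ w₁.asIdeal.under (NumberField.RingOfIntegers K) = v.asIdeal ∧ w₂.asIdeal.under (NumberField.RingOfIntegers K) = v.asIdeal ∧ ∃ β₁ β₂ : Multiset ℂ, P.1.HasSatakeParamAt w₁ β₁ ∧ P.1.HasSatakeParamAt w₂ β₂ ∧ (α.powersetCard 2).map Multiset.prod = β₁ + β₂) ∧ ((¬ ∃ w : IsDedekindDomain.HeightOneSpectrum (NumberField.RingOfIntegers L), w.asIdeal.under (NumberField.RingOfIntegers K) = v.asIdeal ∧ w.asIdeal.inertiaDeg (NumberField.RingOfIntegers K) = 1) → ∃ w : IsDedekindDomain.HeightOneSpectrum (NumberField.RingOfIntegers L), w.asIdeal.under (NumberField.RingOfIntegers K) = v.asIdeal ∧ ∃ β γ : Multiset ℂ, P.1.HasSatakeParamAt w β ∧ γ.map (fun c => c ^ 2) = β ∧ (α.powersetCard 2).map Multiset.prod = γ + γ.map (fun c => -c))) → (∃ η : Literature.NumberTheory.Automorphic.CuspidalAutomorphicRepData 1 K h1, ∀ᶠ v in cofinite, ∀ α : Multiset ℂ, π.1.HasSatakeParamAt v α → ∃ e : ℂ, η.1.HasSatakeParamAt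 v {e} ∧ α.map (fun a => a⁻¹) = α.map (fun a => e * a)) ∨ (∃ (L' : Type) (_ : Field L') (_ : NumberField L') (_ : Algebra K L'), Module.finrank K L' = 2 ∧ ∀ᶠ v : IsDedekindDomain.HeightOneSpectrum (NumberField.RingOfIntegers K) in cofinite, ∀ α : Multiset ℂ, π.1.HasSatakeParamAt v α → α.map (fun a => (if ∃ w : IsDedekindDomain.HeightOneSpectrum (NumberField.RingOfIntegers L'), w.asIdeal.under (NumberField.RingOfIntegers K) = v.asIdeal ∧ w.asIdeal.inertiaDeg (NumberField.RingOfIntegers K) = 1 then (1 : ℂ) else -1) * a) = α)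

/-- item stmt-Langlands-18054 · crux · rank 3 · open · by planner
why it might fail: Fine print of GinzburgRallis2000/Yamana2014 as used in Shavali Prop 4.2 (meromorphy of the PARTIAL ∧³ L-function at s = 1, unitarity/twist normalisation ω_Π²χ⁻¹² = 1, any number field); weights of χ, η must be shown 0 (JS bounds) before non-vanishing at s = 1 applies.
sources: Shavali2026, arXiv:2603.19768, BockleHui2025, GinzburgRallis2000, Yamana2014, Shahidi1997
[crux] Shavali2026 Props 4.1 + 4.2 over ANY number field K (the printed question: Thm A is stated
for totally real K; p. 10 'Throughout this section K is totally real'; Lemma 4.3–Prop. 4.5 need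
ρ_(π') over the quadratic field). Let π be cuspidal on GL_4(𝔸_K) with a Hecke field, not essentially
self-dual and not quadratically self-twisted at Satake level; let ρ : Gal_K → GL_4(ℚ̄_ℓ) be
semisimple, C-compatible with (π, ι) a.e., and REDUCIBLE. Then there are a quadratic L/K and a
cuspidal P on GL_3(𝔸_L) whose automorphic-induction Satake data match the exterior-square Satake
data of π a.e. (the hypothesis of crux 2). Proof line: a stable line τ is impossible (BH Thm 1.1
makes τ and det of the 3-dimensional complement algebraic Hecke characters; the exact eight-term
Frobenius-multiset identity ∧²ρ⊗τ⁻² ⊕ τ⁻³det σ ⊕ 1 = ρ^∨⊗det σ·τ⁻² ⊕ ρ⊗τ⁻¹ gives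
L^S(s,∧²π⊗η⁻²)L^S(s,η⁻³χ)ζ^S_K(s) = L^S(s,π^∨⊗χη⁻²)L^S(s,π⊗η⁻¹): RHS entire, LHS has a pole —
Shahidi1997 non-vanishing); so ρ = σ ⊕ τ with 2-dimensional summands, det σ, det τ algebraic (BH on
∧²ρ), ∧²π cuspidal (AR, since π is neither ess. self-dual nor self-twisted), and Shavali's ∧³∘∧²
virtual identity forces a pole of L^S(s, ∧²π, ∧³⊗χ⁻³) a -/
@[route_item "route-Langlands-ExteriorSquareAscent"]
def ReducibleInducesSquare : Prop :=
  ∀ (K : Type) [Field K] [NumberField K] (h1 : Literature.NumberTheory.Automorphic.isCompact_glFiniteIntegralLevel 1 K) (hcpt : Literature.NumberTheory.Automorphic.isCompact_glFiniteIntegralLevel 4 K) (π : Literature.NumberTheory.Automorphic.CuspidalAutomorphicRepData 4 K hcpt), (∃ E : Subfield ℂ, FiniteDimensional ℚ E ∧ ∀ᶠ v in cofinite, ∀ α : Multiset ℂ, π.1.HasSatakeParamAt v α → ∀ i ≤ 4, ((((Real.sqrt (v.residueCard : ℝ)) : ℝ) : ℂ) ^ (i * (4 - i))) * α.esymm i ∈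 E) → ¬ (∃ η : Literature.NumberTheory.Automorphic.CuspidalAutomorphicRepData 1 K h1, ∀ᶠ v in cofinite, ∀ α : Multiset ℂ, π.1.HasSatakeParamAt v α → ∃ e : ℂ, η.1.HasSatakeParamAt v {e} ∧ α.map (fun a => a⁻¹) = α.map (fun a => e * a)) → ¬ (∃ (L' : Type) (_ : Field L') (_ : NumberField L') (_ : Algebra K L'), Module.finrank K L' = 2 ∧ ∀ᶠ v : IsDedekindDomain.HeightOneSpectrum (NumberField.RingOfIntegers K) in cofinite, ∀ α : Multiset ℂ, π.1.HasSatakeParamAt v α → α.map (fun a => (if ∃ w : IsDedekindDomain.HeightOneSpectrum (NumberField.RingOfIntegers L'), w.asIdeal.under (NumberField.RingOfIntegers K) = v.asIdeal ∧ w.asIdeal.inertiaDeg (NumberField.RingOfIntegers K) = 1 then (1 : ℂ) else -1) * a) = α) → ∀ (ℓ : ℕ) [Fact ℓ.Prime] (ι : PadicAlgCl ℓ ≃+* ℂ) (ρ : Literature.NumberTheory.GaloisRepresentations.FramedGaloisRep K (PadicAlgCl ℓ) 4), ρ.toGaloisRep.IsSemisimple → (∀ᶠ v : IsDedekindDomain.HeightOneSpectrum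 (NumberField.RingOfIntegers K) in cofinite, ∃ α : Multiset ℂ, π.1.HasSatakeParamAt v α ∧ ρ.IsUnramifiedAt v ∧ ρ.HasFrobCharpolyAt v (Literature.NumberTheory.Automorphic.arithFrobPolyOfSatake ι v.residueCard 4 α)) → ¬ ρ.toGaloisRep.IsIrreducible → ∃ (L : Type) (_ : Field L) (_ : NumberField L) (_ : Algebra K L), Module.finrank K L = 2 ∧ ∃ (hL3 : Literature.NumberTheory.Automorphic.isCompact_glFiniteIntegralLevel 3 L) (P : Literature.NumberTheory.Automorphic.CuspidalAutomorphicRepData 3 L hL3), ∀ᶠ v : IsDedekindDomain.HeightOneSpectrum (NumberField.RingOfIntegers K) in cofinite, ∀ α : Multiset ℂ, π.1.HasSatakeParamAt v α → ((∃ w : IsDedekindDomain.HeightOneSpectrum (NumberField.RingOfIntegers L), w.asIdeal.under (NumberField.RingOfIntegers K) = v.asIdeal ∧ w.asIdeal.inertiaDeg (NumberField.RingOfIntegers K) = 1) → ∃ w₁ w₂ : IsDedekindDomain.HeightOneSpectrum (NumberField.RingOfIntegers L), w₁ ≠ w₂ ∧ w₁.asIdeal.under (NumberField.RingOfIntegers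 K) = v.asIdeal ∧ w₂.asIdeal.under (NumberField.RingOfIntegers K) = v.asIdeal ∧ ∃ β₁ β₂ : Multiset ℂ, P.1.HasSatakeParamAt w₁ β₁ ∧ P.1.HasSatakeParamAt w₂ β₂ ∧ (α.powersetCard 2).map Multiset.prod = β₁ + β₂) ∧ ((¬ ∃ w : IsDedekindDomain.HeightOneSpectrum (NumberField.RingOfIntegers L), w.asIdeal.under (NumberField.RingOfIntegers K) = v.asIdeal ∧ w.asIdeal.inertiaDeg (NumberField.RingOfIntegers K) = 1) → ∃ w : IsDedekindDomain.HeightOneSpectrum (NumberField.RingOfIntegers L), w.asIdeal.under (NumberField.RingOfIntegers K) = v.asIdeal ∧ ∃ β γ : Multiset ℂ, P.1.HasSatakeParamAt w β ∧ γ.map (fun c => c ^ 2) = β ∧ (α.powersetCard 2).map Multiset.prod = γ + γ.map (fun c => -c))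

/-- item stmt-Langlands-18055 · crux · rank 4 · open · by planner
why it might fail: Ramakrishnan1994's 1/8 is a (Dirichlet?) density bound and the RS estimate reaches 1/9 only with prime-power control needing θ < 1/8 (7/64, BlomerBrumley2011); a density-notion mismatch, or dihedral f with λ/λ^c of small order, pushes onto the Weil-avatar branch over a non-TR/CM field.
sources: Ramakrishnan1994, BlomerBrumley2011, BockleHui2025, GelbartJacquet1978, ArthurClozelAMS120, LabesseLanglands1979
[crux] the induced case WITHOUT Galois representations over the quadratic field (Shavali Cor. 4.6
writes 'L is either totally real or CM', which fails for mixed-signature quadratic L already over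
totally real K and for non-CM L over CM K). Let π be cuspidal C-algebraic on GL_4(𝔸_K) with a Hecke
field, self-twisted by the quadratic sign of L/K a.e.; then every semisimple C-compatible ρ is
irreducible. Proof line: π = AI_(L/K)(f), f cuspidal on GL_2(𝔸_L), f ≇ f^γ (ArthurClozel / AR Lemma
13); ρ ≅ ρ ⊗ ε_(L/K) (Brauer–Nesbitt), so a reducible ρ either has four characters in ρ|_L (BH over
L ⇒ algebraic Hecke characters ψ_i with t_(f,w) ⊔ t_(f^γ,w) = {ψ_i(w)}: the exact GL(1) product
L^T(s,(f ⊞ f^γ)⊗ψ₁⁻¹) = ζ_L^T(s)·∏_(i≥2) L^T(s,ψ_iψ₁⁻¹) is entire on one side and has a pole on the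
other) or ρ = V ⊕ V⊗ε with W = V|_L irreducible, so t_(f,w) ⊔ t_(f^γ,w) is a doubled pair at every
unramified w: f_w ≅ f^γ_w off the set where t_(f,w) is scalar, which has upper Dirichlet density ≤
1/9 (|tr Ad f_w|² = 9 there against the simple pole of L(s, Ad f × Ad f), prime powers controlled by
the 7/64 bound) when f is non-dihedral — below Ramakrishnan's 1/8, so f ≅ f^γ, contradicting
cuspidality of π; for -/
@[route_item "route-Langlands-ExteriorSquareAscent", crux]
def SelfTwistedIrreducible : Prop :=
  ∀ (K : Type) [Field K] [NumberField K] (hcpt : Literature.NumberTheory.Automorphic.isCompact_glFiniteIntegralLevel 4 K) (π : Literature.NumberTheory.Automorphic.CuspidalAutomorphicRepData 4 K hcpt), π.1.IsCAlgebraic → (∃ E : Subfield ℂ, FiniteDimensional ℚ E ∧ ∀ᶠ v in cofinite, ∀ α : Multiset ℂ, π.1.HasSatakeParamAt v α → ∀ i ≤ 4, ((((Real.sqrt (v.residueCard : ℝ)) : ℝ) : ℂ) ^ (i * (4 - i))) * α.esymm i ∈ E) → (∃ (L' : Type) (_ : Field L') (_ : NumberField L') (_ : Algebra K L'), Module.finrank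 K L' = 2 ∧ ∀ᶠ v : IsDedekindDomain.HeightOneSpectrum (NumberField.RingOfIntegers K) in cofinite, ∀ α : Multiset ℂ, π.1.HasSatakeParamAt v α → α.map (fun a => (if ∃ w : IsDedekindDomain.HeightOneSpectrum (NumberField.RingOfIntegers L'), w.asIdeal.under (NumberField.RingOfIntegers K) = v.asIdeal ∧ w.asIdeal.inertiaDeg (NumberField.RingOfIntegers K) = 1 then (1 : ℂ) else -1) * a) = α) → ∀ (ℓ : ℕ) [Fact ℓ.Prime] (ι : PadicAlgCl ℓ ≃+* ℂ) (ρ : Literature.NumberTheory.GaloisRepresentations.FramedGaloisRep K (PadicAlgCl ℓ) 4), ρ.toGaloisRep.IsSemisimple → (∀ᶠ v : IsDedekindDomain.HeightOneSpectrum (NumberField.RingOfIntegers K) in cofinite, ∃ α : Multiset ℂ, π.1.HasSatakeParamAt v α ∧ ρ.IsUnramifiedAt v ∧ ρ.HasFrobCharpolyAt v (Literature.NumberTheory.Automorphic.arithFrobPolyOfSatake ι v.residueCard 4 α)) → ρ.toGaloisRep.IsIrreducible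

/-- item stmt-Langlands-18056 · crux · rank 5 · open · by planner
why it might fail: It is the summit minus X: open problem (both directions of reciprocity for GL_n over number fields); fails only if the summit statement itself is false or mistyped.
sources: BuzzardGeeLMS2014, FontaineMazurGeometric1995, HarrisLanTaylorThorneRMS2016, Calegari2023
[crux] THE REST OF THE MOUNTAIN (declared open component, hub convention for sector routes on this
all-fields/all-ranks summit, cf. PicardMuOrdinary.SectorComplement, QuadraticWindow.BeyondTheWindow,
IrreducibilityBySelfDuality.IrreducibleOffSector/ReciprocityUpToIrreducibility): IrreducibleGL4 →
Langlands. It contains everything X does not claim — direction (B), existence of avatars and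
local–global compatibility at every finite place, irreducibility for every (n, K, π) outside the
sector (n ≠ 4, or π essentially self-dual, or no Hecke field), the datum Rec — and is trivially
implied by `Langlands`. Not attacked by this route; refuters/judges: grade the route on cruxes 2–4.
[difficulty: open-problem] -/
@[route_item "route-Langlands-ExteriorSquareAscent", crux]
def RestOfReciprocity : Prop :=
  IrreducibleGL4 → _root_.Langlands

/-- item stmt-Langlands-19093 · crux · rank 6 · open · by planner
why it might fail: Formalization debt, not mathematics (JS II Prop. 3.6 / AC (2.3) is a theorem): false AS TYPED only by a normalisation slip in the inlined text (q_w^(1−s₀) vs q_w^(s₀−1), unitary normalisation, α vs β⁻¹); ranks ≤ 2 of this exact text are proved in tree; ranks ≥ 3 hang on an XL archimedean leaf.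
sources: JacquetShalikaAJM1981II, ArthurClozelAMS120, JacquetShalikaAJM1981, ShahidiAJM1981, HumphriesJo2024, CogdellAnalyticTheory2004
[crux] ARTHUR–CLOZEL (2.3) FOR BOREL–JACQUET DATA — PROMOTED LITERATURE INPUT of the junction's line
(route-choice 2026-08-17, unit rchoice-Summits-Langlands-Langlands-Cr-16a26670: the birth skeleton
Cruxes/SectorComplement/Lines/birth.lean of SectorComplement (stmt-Langlands-14623) consumed the
named fact Literature.NumberTheory.Automorphic.JacquetShalika1981_partialPairL_pole_repData as its
stub stub_pairLPoleJS; that fact is judged XL-apex — too large for one prover seat, and non-crux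
Literature facts are not split — so it is promoted to an explicit crux of this route and the line is
rewired to this decl BY NAME). STATEMENT (Jacquet–Shalika II Prop. 3.6 = Arthur–Clozel Ch. 3 §2
(2.3), p. 171, in the Borel–Jacquet model): for cuspidal π, π′ on GL_n(𝔸_F) (n ≥ 1, data
CuspidalAutomorphicRepData, arbitrary central characters) there is a finite S₀ such that for every
finite S ⊇ S₀, all Satake families α, β of π, π′ off S in unitary normalisation (‖∏α_w‖ = ‖∏β_w‖ =
1) and every s₀ on Re s = 1 IN X (q_w^(1−s₀)·α_w = β_w⁻¹ as multisets for almost all w: the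
Hecke-matrix form of π ⊗ |·|^(s₀−1) ≅ σ̃), the limit of (s − s₀)·L^S(s, α × β) as s → s₀ with Re s >
1 exists and is NON-ZERO, wher -/
@[route_item "route-Langlands-ExteriorSquareAscent", crux]
def PairLPoleJS : Prop :=
  ∀ (n : ℕ) (F : Type) [Field F] [NumberField F] (hF : Literature.NumberTheory.Automorphic.isCompact_glFiniteIntegralLevel n F), 0 < n → ∀ (π π' : Literature.NumberTheory.Automorphic.CuspidalAutomorphicRepData n F hF), ∃ S₀ : Set (IsDedekindDomain.HeightOneSpectrum (NumberField.RingOfIntegers F)), S₀.Finite ∧ ∀ {S : Set (IsDedekindDomain.HeightOneSpectrum (NumberField.RingOfIntegers F))}, S.Finite → S₀ ⊆ S → ∀ {α β : IsDedekindDomain.HeightOneSpectrum (NumberField.RingOfIntegers F) → Multiset ℂ}, (∀ w ∉ S, π.1.HasSatakeParamAt w (α w)) → (∀ w ∉ S, π'.1.HasSatakeParamAt w (β w)) → (∀ w ∉ S, ‖(α w).prod‖ = 1) → (∀ w ∉ S, ‖(β w).prod‖ = 1) → ∀ {s₀ : ℂ}, s₀.re = 1 → (∀ᶠ w in cofinite,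 (α w).map ((((w.residueCard : ℂ) ^ (1 - s₀))) * ·) = (β w).map (·⁻¹)) → ∃ c : ℂ, c ≠ 0 ∧ Tendsto (fun s : ℂ => (s - s₀) * ∏' w : {w : IsDedekindDomain.HeightOneSpectrum (NumberField.RingOfIntegers F) // w ∉ S}, ((Literature.NumberTheory.Automorphic.satakePairPolynomial (α w.1) (β w.1)).eval ((w.1.residueCard : ℂ) ^ (-s)))⁻¹) (𝓝[{s : ℂ | 1 < s.re}] s₀) (𝓝 c)

/-- item stmt-Langlands-13622 · crux · rank 7 · open · by planner
why it might fail: Formalization debt, not mathematics (JS II Prop. 3.6 off X + Shahidi non-vanishing = AC (2.2), a theorem): false AS TYPED only by a normalisation slip in the inlined text (q_w^(1−s₀) vs q_w^(s₀−1), unitary normalisation, X-condition n = m ∧ α·q^(1−s₀) = β⁻¹ a.e.).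
sources: JacquetShalikaAJM1981II, ArthurClozelAMS120, JacquetShalikaAJM1981, ShahidiAJM1981
[support] INPUT — Jacquet–Shalika 1981 / Arthur–Clozel Ch. 3 (2.2) for cuspidal Borel–Jacquet data
on GL_n × GL_m: off the X-condition (n = m and, a.e., β_w⁻¹ = q_w^{1−s₀}·α_w as multisets), assuming
unitary central characters a.e. (‖∏ α_w‖ = ‖∏ β_w‖ = 1), the partial Rankin–Selberg product L^S(s, α
× β) = ∏'_{w ∉ S} ∏_{a,b} (1 − a b q_w^{−s})⁻¹ has a finite NON-ZERO limit at Re s₀ = 1 from Re s >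
1. SAME TEXT as
`Literature.NumberTheory.Automorphic.JacquetShalika1981_partialPairL_boundary_repData` with
`partialPairL S α β` unfolded to its defining `tprod` over `satakePairPolynomial`
(RankinSelbergLocal, in the Statement's closure) and `SatakeFamily F` unfolded to `HeightOneSpectrum
(𝓞 F) → Multiset ℂ` — definitionally equal (delta/eta), closes by `exact`/`simpa [partialPairL]` the
day the fact's `_holds` lands (it is reduced in tree to its L² leaves). CONE REPAIR 2026-08-15
(route-repair planner): no import of PairLFunctionPolesRepData (whose closure carried 383 modules /
~45 unproved facts into the cone). Rank 1 (renders before IrreducibleGL3CM). [difficulty: L] -/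
@[route_item "route-Langlands-ExteriorSquareAscent", crux]
def PairLBoundaryJS : Prop :=
  ∀ (n m : ℕ) (F : Type) [Field F] [NumberField F] (hF : _) (hF' : _), 0 < n → 0 < m → ∀ (π : Literature.NumberTheory.Automorphic.CuspidalAutomorphicRepData n F hF) (π' : Literature.NumberTheory.Automorphic.CuspidalAutomorphicRepData m F hF'), ∃ S₀ : Set (IsDedekindDomain.HeightOneSpectrum (NumberField.RingOfIntegers F)), S₀.Finite ∧ ∀ {S : Set (IsDedekindDomain.HeightOneSpectrum (NumberField.RingOfIntegers F))}, S.Finite → S₀ ⊆ S → ∀ {α β : IsDedekindDomain.HeightOneSpectrum (NumberField.RingOfIntegers F) → Multiset ℂ}, (∀ w ∉ S, π.1.HasSatakeParamAt w (α w)) → (∀ w ∉ S, π'.1.HasSatakeParamAt w (β w)) → (∀ w ∉ S, ‖(α w).prod‖ = 1) → (∀ w ∉ S, ‖(β w).prod‖ = 1) → ∀ {s₀ : ℂ}, s₀.re = 1 → ¬ (n = m ∧ ∀ᶠ w in cofinite, (α w).map ((((w.residueCard : ℂ) ^ (1 - s₀))) * ·) = (β w).map (·⁻¹)) → ∃ c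 : ℂ, c ≠ 0 ∧ Tendsto (fun s : ℂ => ∏' w : {w : IsDedekindDomain.HeightOneSpectrum (NumberField.RingOfIntegers F) // w ∉ S}, ((Literature.NumberTheory.Automorphic.satakePairPolynomial (α w.1) (β w.1)).eval ((w.1.residueCard : ℂ) ^ (-s)))⁻¹) (𝓝[{s : ℂ | 1 < s.re}] s₀) (𝓝 c)

/-- item stmt-Langlands-18128 · crux · rank 8 · open · by planner
why it might fail: A theorem in print (AR 2007 Thm 1 (i)⇒(iii)); false only AS TYPED, e.g. if a CuspidalAutomorphicRepData 4 F (constituent datum: no unitarity/genericity field) escapes AR's 'cuspidal automorphic representation'. Printed proof needs Kim's ∧² WITH unitarity (absent from Kim2003_exteriorSquare_GL4).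
sources: AsgariRaghuram2007, arXiv:0712.4315, Kim2003, JacquetShalikaAJM1981II
[crux] ASGARI–RAGHURAM 2007 Thm 1 (i)⇒(iii) FOR BOREL–JACQUET DATA — PROMOTED LITERATURE INPUT of
the registered line `Sketch` of crux 3 (route-choice 2026-08-17, unit
rchoice-Summits-Langlands-Langlands-Cr-6cc5c7dc: the skeleton
Cruxes/ReducibleInducesSquare/Lines/Sketch.lean of ReducibleInducesSquare (stmt-Langlands-18054)
consumed the named fact
Literature.NumberTheory.Automorphic.AsgariRaghuram2007_selfDual_or_selfTwist_of_wedgeTwo_not_cuspidal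
as its fact-stub stub_factAR, feeding stub_wedgeTwoCuspidal = the CUSPIDAL GL_6 datum Π with t_Π =
∧²t_π used by both analytic stubs; the fact is judged XL-apex — no GSpin automorphy datum, no
Langlands–Shahidi L-functions, no isobaric sums in the tree — and non-crux Literature facts are not
split, so it is promoted to an explicit crux of this route and the line is rewired to this decl BY
NAME. Re-route rejected: without the cuspidal ∧² datum the (3,1)/(2,2) Euler-product identities of
the line do not exist (RS(4×4)+Hecke alone: nullity 0, evidence rs_identity_search.py on 18054), and
AR over the quadratic field is the lever of crux 2 InducedSquareAscent itself
(stub_selfDualOrSelfTwistOverL of Cruxes/InducedSquareAscent/Lines/birth.lean -/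
@[route_item "route-Langlands-ExteriorSquareAscent", crux]
def WedgeTwoNotCuspidalAR : Prop :=
  ∀ (F : Type) [Field F] [NumberField F] (h1 : Literature.NumberTheory.Automorphic.isCompact_glFiniteIntegralLevel 1 F) (h4 : Literature.NumberTheory.Automorphic.isCompact_glFiniteIntegralLevel 4 F) (h6 : Literature.NumberTheory.Automorphic.isCompact_glFiniteIntegralLevel 6 F) (π : Literature.NumberTheory.Automorphic.CuspidalAutomorphicRepData 4 F h4), (¬ ∃ P : Literature.NumberTheory.Automorphic.CuspidalAutomorphicRepData 6 F h6, ∀ᶠ v : IsDedekindDomain.HeightOneSpectrum (NumberField.RingOfIntegers F) in cofinite, ∀ α : Multiset ℂ, π.1.HasSatakeParamAt v α → P.1.HasSatakeParamAt v ((α.powersetCard 2).map Multiset.prod)) → (∃ η : Literature.NumberTheory.Automorphic.CuspidalAutomorphicRepData 1 F h1, ∀ᶠ v : IsDedekindDomain.HeightOneSpectrum (NumberField.RingOfIntegers F) in cofinite, ∀ α : Multiset ℂ, π.1.HasSatakeParamAt v α → ∃ e : ℂ, η.1.HasSatakeParamAt v {e} ∧ α.map (fun a => a⁻¹) = α.map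 (fun a => e * a)) ∨ (∃ ξ : Literature.NumberTheory.Automorphic.CuspidalAutomorphicRepData 1 F h1, (¬ ∀ᶠ v : IsDedekindDomain.HeightOneSpectrum (NumberField.RingOfIntegers F) in cofinite, ξ.1.HasSatakeParamAt v {1}) ∧ ∀ᶠ v : IsDedekindDomain.HeightOneSpectrum (NumberField.RingOfIntegers F) in cofinite, ∀ α : Multiset ℂ, π.1.HasSatakeParamAt v α → ∃ e : ℂ, ξ.1.HasSatakeParamAt v {e} ∧ α.map (fun a => e * a) = α)

/-- item stmt-Langlands-18110 · support · rank 9 · open · by planner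
[support] GLUE (route-repair 2026-08-17, unused-crux PairLPoleJS / PairLBoundaryJS): the open
component RestOfReciprocity NET of the two Jacquet–Shalika pair-L formalisation debts —
`PairLBoundaryJS → PairLPoleJS → RestOfReciprocity`. Trivially implied by RestOfReciprocity (seam
`fun h _ _ => h`); conversely it is exactly what the registered line
Cruxes/RestOfReciprocity/Lines/birth.lean (rev 2: stubs stub_reciprocityUpToIrreducibilityR =
stmt-Langlands-17925 verbatim, stub_pairLBoundaryJS = stmt-Langlands-13622, stub_pairLPoleJS =
stmt-Langlands-19093; composition RestOfReciprocity_of sorry-free) proves from its remaining stub R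
— the day stmt-Langlands-17925 lands, `fun h22 h23 => RestOfReciprocity_of R_holds h22 h23`
(equivalently
Theorems/ExteriorSquareAscentRestOfReciprocityOfR.restOfReciprocity_of_reciprocityUpToIrreducibilityR_text_of_JS,
p159344, through the Iff.rfl bridges pairLBoundaryJS_iff / pairLPoleJS_iff) closes this item in
three lines. Purpose: the deciding theorem is re-certified as `closes (h2 : InducedSquareAscent) (h3
: ReducibleInducesSquare) (h4 : SelfTwistedIrreducible) (h6 : PairLPoleJS) (h7 : PairLBoundaryJS)
(h8 : RestOfReciprocityGivenJS) : Langlands := -/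
@[route_item "route-Langlands-ExteriorSquareAscent", crux]
def RestOfReciprocityGivenJS : Prop :=
  PairLBoundaryJS → PairLPoleJS → RestOfReciprocity

/-- item stmt-Langlands-18147 · support · rank 9 · closed · proved by Summit.Langlands.Langlands.Cruxes.ReducibleInducesSquare.Sketch.reducibleInducesSquareGivenJSAR @ 3b4ecd231b87 (prover) · by planner
[support] GLUE #2 (route-repair 2026-08-17, unused-crux WedgeTwoNotCuspidalAR — promoted
support→crux r8 at rev 6 by route-choice rchoice-Summits-Langlands-Langlands-Cr-6cc5c7dc, which left
the wiring 'at the rrepair planner's discretion, through a GivenAR glue binder like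
RestOfReciprocityGivenJS'): crux 3 ReducibleInducesSquare GIVEN its three promoted Literature inputs
— `PairLBoundaryJS → PairLPoleJS → WedgeTwoNotCuspidalAR → ReducibleInducesSquare` (JS (2.2), JS
(2.3), AR Thm 1 (i)⇒(iii)). Trivially implied by ReducibleInducesSquare (seam `fun h _ _ _ => h`);
conversely it is exactly what the registered line Cruxes/ReducibleInducesSquare/Lines/Sketch.lean
proves from its seven native stubs: its composition is `ReducibleInducesSquare_of (hJ22 :
stub_factJS22) (hJ23 : stub_factJS23) (hAR : stub_factAR) (hA : stub_lineHecke) (hB :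
stub_planesBlocks) (hC : stub_planesAmbient) (hD : stub_planesHecke) (hW : stub_wedgeTwoCuspidal)
(hE : stub_noLineAnalytic) (hF : stub_noPlanesAnalytic)`, the three fact-stubs being the texts of
stmt-Langlands-13622 / stmt-Langlands-19093 / stmt-Langlands-18128 (Iff.rfl), so `fun h22 h23 hAR =>
ReducibleInducesSquare_of h22 h23 hAR A B C D W E F` close -/
@[route_item "route-Langlands-ExteriorSquareAscent", crux]
def ReducibleInducesSquareGivenJSAR : Prop :=
  PairLBoundaryJS → PairLPoleJS → WedgeTwoNotCuspidalAR → ReducibleInducesSquare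

-- `ReducibleInducesSquareGivenJSAR` holds: proved by `Summit.Langlands.Langlands.Cruxes.ReducibleInducesSquare.Sketch.reducibleInducesSquareGivenJSAR` @ 3b4ecd231b87 (its module imports this route file, so no `_holds` link can be stated here).

/-- item stmt-Langlands-18057 · assembly · rank 1 · open · by planner
sources: Shavali2026, AsgariRaghuram2007
[assembly] InducedSquareAscent → ReducibleInducesSquare → SelfTwistedIrreducible → RestOfReciprocity
→ Langlands. -/
@[route_item "route-Langlands-ExteriorSquareAscent"]
def Assembly : Prop :=
  InducedSquareAscent → ReducibleInducesSquare → SelfTwistedIrreducible → RestOfReciprocity → _root_.Langlands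

/-! D-0027 §2.1 — DECIDING THEOREM (planner-authored via `route open/edit --closes-file`; by planner-rrepair-Langlands-ExteriorSquareAscent-91ef19e5-0 2026-08-17T13:12:16Z):
its hypotheses are this route's items and its conclusion the sub-problem Statement (glue_lint), and it elaborates with this file. -/

@[closes "route-Langlands-ExteriorSquareAscent"] theorem closes (h2 : InducedSquareAscent) (h4 : SelfTwistedIrreducible)
    (h6 : PairLPoleJS) (h7 : PairLBoundaryJS) (h9 : WedgeTwoNotCuspidalAR)
    (h3 : ReducibleInducesSquareGivenJSAR) (h8 : RestOfReciprocityGivenJS) : _root_.Langlands := by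
  -- D-0027 §2.1 deciding theorem (route-repair unused-crux, 2026-08-17, unit rrepair-…-91ef19e5): the three promoted
  -- Literature inputs (r6 PairLPoleJS, r7 PairLBoundaryJS, r8 WedgeTwoNotCuspidalAR) are load-bearing through the two glue items
  -- ReducibleInducesSquareGivenJSAR (= JS22 → JS23 → AR → crux 3) and RestOfReciprocityGivenJS (= JS22 → JS23 → RestOfReciprocity);
  -- X = IrreducibleGL4 is derived from cruxes 2–4 exactly as at birth, crux 3 being `h3 h7 h6 h9`.
  refine h8 h7 h6 ?_
  intro K _ _ h1 hcpt π hCalg hE hNE ℓ _ ι ρ hss hcomp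
  by_contra hirr
  by_cases hST : ∃ (L' : Type) (_ : Field L') (_ : NumberField L') (_ : Algebra K L'), Module.finrank K L' = 2 ∧ ∀ᶠ v : IsDedekindDomain.HeightOneSpectrum (NumberField.RingOfIntegers K) in cofinite, ∀ α : Multiset ℂ, π.1.HasSatakeParamAt v α → α.map (fun a => (if ∃ w : IsDedekindDomain.HeightOneSpectrum (NumberField.RingOfIntegers L'), w.asIdeal.under (NumberField.RingOfIntegers K) = v.asIdeal ∧ w.asIdeal.inertiaDeg (NumberField.RingOfIntegers K) = 1 then (1 : ℂ) else -1) * a) = α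
  · exact hirr (h4 K hcpt π hCalg hE hST ℓ ι ρ hss hcomp)
  · obtain ⟨L, _, _, _, hdeg, hL3, P, hind⟩ := h3 h7 h6 h9 K h1 hcpt π hE hNE hST ℓ ι ρ hss hcomp hirr
    rcases h2 K h1 hcpt π L hdeg hL3 P hind with hsd | hst
    · exact hNE hsd
    · exact hST hst

end Summit.Langlands.Langlands.Theses.ExteriorSquareAscent
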